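import Mathlib
import Summits.Ventures.HodgeRepro2.Tier7.Line3.DenominatorBound

/-!
# Tier7/Line3/AlmostAllIntegral — a rational matrix is integral with unit determinant at almost all finite places
(seat t7-L1-p4)

LINE 3 (t7-plan-3), version (ii), memo §2 choice (c) of the test function: «choose a regular `γ₀ ∈ U(W_A)(F)` … and
let `S` = the archimedean places ∪ the ramified places ∪ `{v : γ₀ ∉ K_v}` ∪ `{v₁}`» — `S` is defined AFTER `γ₀`, and
outside `S` the unramified weight of `γ₀` is the volume of `K_v` (`γ₀ ∈ K_v`). crit-2's scope objection on
`ArchFiniteCompat` (STATUS l. 15259 / review/OBJECTION-ArchFiniteCompat-scope-t7-crit-2.md): the places `v ∉ T`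
must be controlled; its option (b) is exactly the memo's order «`T`/`S` chosen after `γ₀`». THIS FILE types the fact that
makes (b) well-defined: the set `{v : γ₀ ∉ K_v}` is FINITE — for ANY number field `K` and ANY square matrix `γ` over `K`
with `det γ ≠ 0`, there is a finite set `S` of finite places outside which every entry of `γ` is integral, `det γ` is a
unit, and every entry of `γ⁻¹` is integral:

* `valuationRing w := {x | w x ≤ 1}` (Mathlib's `Valuation.integer` of the place's valuation), `mem_valuationRing_iff`;
* `finite_not_le_one`: `{w | ¬ w x ≤ 1}` is finite for every `x` (`FinitePlace.hasFiniteMulSupport`);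
* `apply_det_le_one` / `apply_adjugate_le_one`: integral entries give integral determinant and adjugate
  (`RingHom.map_det` / `RingHom.map_adjugate` along the subring);
* **`exists_finset_matrix`**: `∃ S, ∀ w ∉ S, (∀ i j, w (γ i j) ≤ 1) ∧ w γ.det = 1 ∧ ∀ i j, w (γ⁻¹ i j) ≤ 1`.

What stays in words: that «`γ₀ ∈ K_v`» for the real `U(W_A)(F_v)` and its maximal compact `K_v` is the matrix condition
above in the adapted basis (the dictionary; `K_v = U(W_A)(F_v) ∩ GL₂(𝓞_{E_v})` at the unramified places); the memo's
choice of `S` after `γ₀` (its §2 (c)). Nothing about (N); no device. No sorry; axioms ⊆ {propext, Classical.choice, Quot.sound}.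
-/

namespace Summit.Ventures.HodgeRepro2.Tier7.Line3.AlmostAllIntegral

open NumberField IsDedekindDomain Summit.Ventures.HodgeRepro2.Tier7.Line3.DenominatorBound

variable {K : Type*} [Field K] [NumberField K]

/-- the valuation ring of a finite place `w`: the subring `{x | w x ≤ 1}` (Mathlib's `Valuation.integer`). -/
noncomputable def valuationRing (w : FinitePlace K) : Subring K :=
  ((FinitePlace.maximalIdeal w).valuation K).integer

/-- `x ∈ valuationRing w ↔ w x ≤ 1`. -/
theorem mem_valuationRing_iff (w : FinitePlace K) (x : K) : x ∈ valuationRing w ↔ w x ≤ 1 := by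
  rw [valuationRing, Valuation.mem_integer_iff, apply_le_one_iff]

/-- **finitely many places see a denominator**: `{w | ¬ w x ≤ 1}` is finite. -/
theorem finite_not_le_one (x : K) : {w : FinitePlace K | ¬ w x ≤ 1}.Finite := by
  by_cases hx : x = 0
  · subst hx
    have : {w : FinitePlace K | ¬ w 0 ≤ 1} = ∅ := by
      ext w
      simp only [map_zero, zero_le_one, not_true_eq_false, Set.mem_setOf_eq, Set.mem_empty_iff_false]
    rw [this]
    exact Set.finite_empty
  · exact (finite_support hx).subset fun w hw => fun h1 => hw (h1 ▸ le_refl (1 : ℝ))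

section Matrix

variable {n : Type*} [Fintype n]

/-- the places where some entry of a matrix has a denominator form a finite set. -/
theorem finite_entries (γ : Matrix n n K) : {w : FinitePlace K | ∃ i j, ¬ w (γ i j) ≤ 1}.Finite := by
  have h : {w : FinitePlace K | ∃ i j, ¬ w (γ i j) ≤ 1} =
      ⋃ i, ⋃ j, {w : FinitePlace K | ¬ w (γ i j) ≤ 1} := by
    ext w
    simp only [Set.mem_setOf_eq, Set.mem_iUnion]
  rw [h]
  exact Set.finite_iUnion fun i => Set.finite_iUnion fun j => finite_not_le_one (γ i j)

variable [DecidableEq n]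

/-- a matrix with entries in the valuation ring, as a matrix over the subring. -/
noncomputable def toSubring (w : FinitePlace K) (γ : Matrix n n K) (h : ∀ i j, w (γ i j) ≤ 1) :
    Matrix n n (valuationRing w) :=
  fun i j => ⟨γ i j, (mem_valuationRing_iff w _).2 (h i j)⟩

/-- the subring matrix maps back to `γ`. -/
theorem mapMatrix_toSubring (w : FinitePlace K) (γ : Matrix n n K) (h : ∀ i j, w (γ i j) ≤ 1) :
    (valuationRing w).subtype.mapMatrix (toSubring w γ h) = γ := by
  ext i j
  rfl

/-- **integral entries give an integral determinant**. -/
theorem apply_det_le_one (w : FinitePlace K) (γ : Matrix n n K) (h : ∀ i j, w (γ i j) ≤ 1) :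
    w γ.det ≤ 1 := by
  rw [← mem_valuationRing_iff, ← mapMatrix_toSubring w γ h, ← RingHom.map_det]
  exact SetLike.coe_mem _

/-- **integral entries give an integral adjugate**. -/
theorem apply_adjugate_le_one (w : FinitePlace K) (γ : Matrix n n K) (h : ∀ i j, w (γ i j) ≤ 1) (i j : n) :
    w (γ.adjugate i j) ≤ 1 := by
  rw [← mem_valuationRing_iff, ← mapMatrix_toSubring w γ h, ← RingHom.map_adjugate]
  exact SetLike.coe_mem _

/-- **integral entries and a unit determinant give an integral inverse**. -/
theorem apply_inv_le_one (w : FinitePlace K) (γ : Matrix n n K) (h : ∀ i j, w (γ i j) ≤ 1)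
    (hdet : w γ.det = 1) (i j : n) : w (γ⁻¹ i j) ≤ 1 := by
  rw [Matrix.inv_def, Ring.inverse_eq_inv', Matrix.smul_apply, smul_eq_mul, map_mul, map_inv₀, hdet, inv_one,
    one_mul]
  exact apply_adjugate_le_one w γ h i j

/-- **a rational matrix lies in `GLₙ(𝓞_w)` for almost all finite places `w`**: for `det γ ≠ 0` there is a finite set `S`
of finite places outside which the entries of `γ` are integral, `det γ` is a unit and the entries of `γ⁻¹` are
integral. -/
theorem exists_finset_matrix (γ : Matrix n n K) (hγ : γ.det ≠ 0) :
    ∃ S : Finset (FinitePlace K), ∀ w ∉ S,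
      (∀ i j, w (γ i j) ≤ 1) ∧ w γ.det = 1 ∧ ∀ i j, w (γ⁻¹ i j) ≤ 1 := by
  classical
  have hfin : ({w : FinitePlace K | ∃ i j, ¬ w (γ i j) ≤ 1} ∪ {w | w γ.det ≠ 1}).Finite :=
    (finite_entries γ).union (finite_support hγ)
  refine ⟨hfin.toFinset, fun w hw => ?_⟩
  rw [Set.Finite.mem_toFinset, Set.mem_union, not_or] at hw
  obtain ⟨h1, h2⟩ := hw
  have hent : ∀ i j, w (γ i j) ≤ 1 := fun i j => by
    by_contra h
    exact h1 ⟨i, j, h⟩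
  have hdet : w γ.det = 1 := by
    by_contra h
    exact h2 h
  exact ⟨hent, hdet, apply_inv_le_one w γ hent hdet⟩

end Matrix

end Summit.Ventures.HodgeRepro2.Tier7.Line3.AlmostAllIntegral
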